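import Mathlib
import HarnessLib
import Literature.MathematicalPhysics.QuantumFieldTheory.ConstructiveQFTWave0
import Literature.Barriers.QuantumFields.ElitzurTheorem
import Summits.Ventures.LatticeQCDFlow.Exactness.LatticeCoordAvg

/-!
# LatticeQCDFlow / Scaling — gauge redundancy of the link-variable autoregressive context:
# partial Haar marginals of gauge-invariant weights are gauge invariant, and a link with a
# buried endpoint drops out of every later conditional (plaquette-mates included)

HONEST FRAMING: exact (Metropolis-corrected) sampling algorithms for lattice gauge theory;
figures of merit are autocorrelation/cost numbers at stated couplings and volumes; no
continuum-physics claim.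

Venture `LatticeQCDFlow` (cell pub-lqcd), topic `Scaling`, FANOUT row 30 (lean-1, GEN-15) — OUR WORK
on THEORY-2.md §4 row **C5** (faithfulness of the exact autoregressive / Knothe–Rosenblatt context
for INTERACTING targets: "for the Wilson / φ⁴ lattice actions … the exact KR map in a given
ordering has EXACTLY the symbolic sparsity (no component is sparser than `neigh(k, G^k) ∪ {k}`), as
for generic Gaussians"), the one cell of row T2-AF left open by GEN-14's autoregressive-context
volume law (`Scaling/EliminationFrontComponents`, `…/StieltjesCholeskyFill`, `…/AutoregressiveContextLaw`:
for the free field the context of a site IS its fill neighbourhood, no cancellation).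

THE GAUGE CASE IS NOT FAITHFUL IN LINK VARIABLES.  An exact autoregressive sampler of the Wilson
theory in link variables `U : Edge d L → G` generates the links in some order; the conditional law
of link `a` given the links already generated, `P`, integrates the links not yet generated,
`s` (all against product Haar `⊗ₑ dU_e`): its density is the ratio of two PARTIAL HAAR MARGINALS
`A_s w (U) / A_{s ∪ {a}} w (U)` of the weight `w = e^{−β S_W}`, where
`A_s F (U) = ∫ F(s.piecewise V U) d(⊗Haar)(V)` is the tree's coordinate average
`Exactness.coordAvg (haarProbability G) s F U` (`Exactness/LatticeCoordAvg.lean`; it is the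
conditional expectation given the links off `s`: `integral_sub_coordAvg_mul_eq_zero`).

This file is the MECHANISM (every group `G` with its Haar probability measure, every `d`, `L`,
every gauge-invariant `F`, no continuity or integrability needed); the Wilson witness and the
verdict on C5 are the sequel `Scaling/AutoregressiveGaugeRedundancyWilson.lean`.

* §0 single-site gauge rotations `Pi.mulSingle x g` act on a non-loop link at `x` by `U_ℓ ↦ g·U_ℓ`
  (outgoing) / `U_ℓ ↦ U_ℓ·g⁻¹` (incoming), transitively (`exists_gaugeTransform_mulSingle_apply_eq`),
  and fix links away from `x`; `gaugeTransform_piecewise` (gauge transformations commute with gluing).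
* §1 `coordAvg_congr_off` (the marginal reads only the links off `s`);
  **`coordAvg_gaugeTransform`**: `A_s F (U^γ) = A_s (F ∘ (·)^γ) (U)` for EVERY `F`, `s`, `γ` — a gauge
  transformation is a link-by-link two-sided translation, which preserves product Haar measure
  (tree `Elitzur.integral_comp_gaugeTransform`); hence **`isGaugeInvariant_coordAvg`**: partial Haar
  marginals of gauge-invariant weights are gauge invariant (a marginal of a lattice gauge theory is
  a lattice gauge theory), and the MASTER IDENTITY **`coordAvg_eq_of_gaugeRelated_off`**: `A_s F`
  takes the same value on `U` and on any `U'` that agrees OFF `s` with some gauge transform of `U` —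
  the exact conditionals read the retained links only modulo gauge, tested off `s`.  Two-link case
  `coordAvg_pathHolonomy`: an incoming and an outgoing retained link at an otherwise integrated site
  are read only through their product (path holonomy).
* §2 BURIAL.  A link `ℓ`, not a loop, is BURIED by `s` at its endpoint `x` when every OTHER link at
  `x` lies in `s`.  **`coordAvg_update_of_buried`**: for gauge-invariant `F`,
  `A_s F (U[ℓ ↦ h]) = A_s F (U)` for every `h : G` — the marginal does not depend on `U_ℓ` AT ALL
  (the rotation at `x` realising `U_ℓ ↦ h` moves only `s`-links otherwise);
  `coordAvg_eq_of_forall_buried` (several buried links at once).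
* §3 THE AUTOREGRESSIVE READING, def-free.  **`arConditional_update_of_buried`**: if the generated
  link `ℓ` is buried by the not-yet-generated links `s`, the conditional density
  `A_s F / A_{insert a s} F` of the next link `a` given the generated links takes the same value at `U`
  and at `U[ℓ ↦ h]`: `ℓ` is NOT in the context of `a` — whatever the plaquette-sharing graph says.

READING (value-free, for THEORY-2 §4 C5 / T2-AF): in LINK variables the exact autoregressive
context of a pure gauge theory is the graph-theoretic (fill-neighbourhood) prediction REDUCED BY
GAUGE: retained links enter only through gauge classes tested off the integrated set — buried links
not at all, chains through integrated sites only through their holonomies — for every gauge group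
and every gauge-invariant weight (any coupling, any action).  The sequel shows the reduction is
STRICT for the Wilson action (a plaquette-mate drops out), so C5 as worded fails for gauge links;
the faithful count must be made modulo gauge.  NOT CLAIMED: a lower bound on the gauge-reduced
context (open in `d ≥ 3`; in `d = 2` the plaquette variables off one puncture are exactly i.i.d.
Haar under product Haar measure — lean-1 GEN-5 `PlaquetteMarginals2D` — so the gauge-reduced
interaction is one global constraint); faithfulness for `φ⁴` (C5's other half, expected TRUE, not
typed); anything about approximate samplers.  Nearest prints: gauge fixing on a maximal tree — the
INTEGRATED form `∫ F = ∫ F(U[T ↦ 1])` (M. Creutz, *Quarks, gluons and lattices* (1983) Ch. 9;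
C. Gattringer, C. B. Lang, LNP 788 (2010) §3.2.2; tree `Scaling/LatticeTreeGauge`); the pointwise
partial-marginal / conditional form is, as far as searched (corpus + galaxy, 2026-08-24), not in
print.  Elementary over the tree (`gaugeTransform`, `IsGaugeInvariant`, `haarProbability`,
`Exactness.coordAvg`, `Elitzur.integral_comp_gaugeTransform`); no definition is introduced; nothing
is cited as a fact; no `sorry`.
-/

noncomputable section

namespace Summit.Ventures.LatticeQCDFlow.Theory2.Autoregressive

open MeasureTheory Function
open Literature.MathematicalPhysics.QuantumFieldTheory
open Summit.Ventures.LatticeQCDFlow.Exactness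

variable {d L N : ℕ} {G : Type*} [Group G]

/-! ## §0 Link bookkeeping: single-site gauge rotations -/

section Algebra

/-- A gauge transformation glues with `Finset.piecewise`: transforming the glued configuration is
gluing the transformed ones (link by link). [ours] -/
theorem gaugeTransform_piecewise (γ : Site d L → G) (s : Finset (Edge d L)) (V U : GaugeConfig d L G) :
    gaugeTransform γ (s.piecewise V U) = s.piecewise (gaugeTransform γ V) (gaugeTransform γ U) := by
  funext e
  by_cases he : e ∈ s
  · simp [gaugeTransform, Finset.piecewise_eq_of_mem _ _ _ he]
  · simp [gaugeTransform, Finset.piecewise_eq_of_notMem _ _ _ he]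

/-- The gauge rotation by `g` at the single site `x` (`Pi.mulSingle x g`) does not move a link
none of whose endpoints is `x`. [ours] -/
theorem gaugeTransform_mulSingle_apply_of_not_incident (x : Site d L) (g : G) (U : GaugeConfig d L G)
    {e : Edge d L} (h1 : e.1 ≠ x) (h2 : e.1.shift e.2 ≠ x) :
    gaugeTransform (Pi.mulSingle x g) U e = U e := by
  simp [gaugeTransform, Pi.mulSingle_eq_of_ne h1, Pi.mulSingle_eq_of_ne h2]

/-- On a link `ℓ` STARTING at `x` (and not a loop) the rotation by `g` at `x` is left
multiplication: `U_ℓ ↦ g·U_ℓ`. [ours] -/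
theorem gaugeTransform_mulSingle_apply_of_fst_eq {x : Site d L} (g : G) (U : GaugeConfig d L G)
    {ℓ : Edge d L} (h1 : ℓ.1 = x) (h2 : ℓ.1.shift ℓ.2 ≠ x) :
    gaugeTransform (Pi.mulSingle x g) U ℓ = g * U ℓ := by
  subst h1
  simp [gaugeTransform, Pi.mulSingle_eq_of_ne h2]

/-- On a link `ℓ` ENDING at `x` (and not a loop) the rotation by `g` at `x` is right
multiplication by `g⁻¹`: `U_ℓ ↦ U_ℓ·g⁻¹`. [ours] -/
theorem gaugeTransform_mulSingle_apply_of_shift_eq {x : Site d L} (g : G) (U : GaugeConfig d L G)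
    {ℓ : Edge d L} (h1 : ℓ.1 ≠ x) (h2 : ℓ.1.shift ℓ.2 = x) :
    gaugeTransform (Pi.mulSingle x g) U ℓ = U ℓ * g⁻¹ := by
  subst h2
  simp [gaugeTransform, Pi.mulSingle_eq_of_ne h1]

/-- **The single-site rotation realises any prescribed value on a non-loop link at the site**:
for `ℓ` incident to `x`, not a loop, and any `h : G` there is `g` with `(U^{g at x})_ℓ = h`
(`g = h·U_ℓ⁻¹` if `ℓ` starts at `x`, `g = h⁻¹·U_ℓ` if it ends there). [ours] -/
theorem exists_gaugeTransform_mulSingle_apply_eq {x : Site d L} (U : GaugeConfig d L G) {ℓ : Edge d L}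
    (hinc : ℓ.1 = x ∨ ℓ.1.shift ℓ.2 = x) (hloop : ℓ.1 ≠ ℓ.1.shift ℓ.2) (h : G) :
    ∃ g : G, gaugeTransform (Pi.mulSingle x g) U ℓ = h := by
  rcases hinc with h1 | h2
  · refine ⟨h * (U ℓ)⁻¹, ?_⟩
    have h2 : ℓ.1.shift ℓ.2 ≠ x := fun h2 => hloop (h1.trans h2.symm)
    rw [gaugeTransform_mulSingle_apply_of_fst_eq _ U h1 h2, inv_mul_cancel_right]
  · refine ⟨h⁻¹ * U ℓ, ?_⟩
    have h1 : ℓ.1 ≠ x := fun h1 => hloop (h1.trans h2.symm)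
    rw [gaugeTransform_mulSingle_apply_of_shift_eq _ U h1 h2, mul_inv_rev, inv_inv,
      mul_inv_cancel_left]

end Algebra

/-! ## §1 Partial Haar marginals commute with gauge transformations -/

section Marginal

variable [TopologicalSpace G] [IsTopologicalGroup G] [CompactSpace G] [MeasurableSpace G]
  [BorelSpace G]

/-- The partial Haar marginal `A_s F` reads only the links OFF `s`: configurations that agree off
`s` have the same marginal. [ours] -/
theorem coordAvg_congr_off [NeZero L] (s : Finset (Edge d L)) (F : GaugeConfig d L G → ℝ)
    {U U' : GaugeConfig d L G} (h : ∀ e, e ∉ s → U e = U' e) :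
    coordAvg (haarProbability G) s F U = coordAvg (haarProbability G) s F U' := by
  unfold coordAvg
  congr 1
  funext V
  congr 1
  funext e
  by_cases he : e ∈ s
  · simp [Finset.piecewise_eq_of_mem _ _ _ he]
  · simp [Finset.piecewise_eq_of_notMem _ _ _ he, h e he]

/-- **Partial Haar marginals commute with gauge transformations**: for EVERY `F`, `s`, `γ`,
`A_s F (U^γ) = A_s (F ∘ (·)^γ) (U)` — change variables `V ↦ V^γ` in the integrated links (product
Haar measure is gauge invariant, tree `Elitzur.integral_comp_gaugeTransform`) and glue
(`gaugeTransform_piecewise`). [ours] -/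
theorem coordAvg_gaugeTransform [NeZero L] (γ : Site d L → G) (s : Finset (Edge d L))
    (F : GaugeConfig d L G → ℝ) (U : GaugeConfig d L G) :
    coordAvg (haarProbability G) s F (gaugeTransform γ U) =
      coordAvg (haarProbability G) s (F ∘ gaugeTransform γ) U := by
  unfold coordAvg
  rw [← Literature.Barriers.QuantumFields.Elitzur.integral_comp_gaugeTransform γ
    (fun V => F (s.piecewise V (gaugeTransform γ U)))]
  simp only [Function.comp_apply, gaugeTransform_piecewise]

/-- **A partial Haar marginal of a gauge-invariant weight is gauge invariant** — for every set `s`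
of integrated links: a marginal of a lattice gauge theory is a lattice gauge theory (with an induced
multi-link action). [ours] -/
theorem isGaugeInvariant_coordAvg [NeZero L] (s : Finset (Edge d L)) {F : GaugeConfig d L G → ℝ}
    (hF : IsGaugeInvariant F) : IsGaugeInvariant (coordAvg (haarProbability G) s F) := by
  intro γ U
  rw [coordAvg_gaugeTransform]
  have : F ∘ gaugeTransform γ = F := funext fun V => hF γ V
  rw [this]

/-- **The master identity: the marginal reads the retained links only modulo gauge, tested off
`s`.**  If `U'` agrees OFF `s` with some gauge transform `U^γ` of `U` (on `s` the three may differ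
arbitrarily), then `A_s F (U') = A_s F (U)` for gauge-invariant `F`.  Special cases: `γ`
supported on sites all of whose links but one lie in `s` (BURIAL, §2: that link drops out);
`γ` supported on a site `y` whose links outside `s` are exactly an incoming `ℓ₁` and an outgoing
`ℓ₂` (the marginal reads `U_{ℓ₁}`, `U_{ℓ₂}` only through the path holonomy `U_{ℓ₁} U_{ℓ₂}`);
global `γ` (covariance of every exact conditional). [ours] -/
theorem coordAvg_eq_of_gaugeRelated_off [NeZero L] (s : Finset (Edge d L))
    {F : GaugeConfig d L G → ℝ} (hF : IsGaugeInvariant F) (γ : Site d L → G)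
    {U U' : GaugeConfig d L G} (h : ∀ e, e ∉ s → U' e = gaugeTransform γ U e) :
    coordAvg (haarProbability G) s F U' = coordAvg (haarProbability G) s F U := by
  rw [coordAvg_congr_off s F h]
  exact isGaugeInvariant_coordAvg s hF γ U

/-- **Path-holonomy reduction** (the two-link case of the master identity): if the links at the
site `y` outside `s` are exactly `ℓ₁`, ENDING at `y`, and `ℓ₂ ≠ ℓ₁`, STARTING at `y` (neither a
loop), then for gauge-invariant `F` the marginal `A_s F` reads `U_{ℓ₁}`, `U_{ℓ₂}` only through the
product `U_{ℓ₁}·U_{ℓ₂}`: replacing `(U_{ℓ₁}, U_{ℓ₂})` by `(U_{ℓ₁} g⁻¹, g U_{ℓ₂})` changes nothing.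
[ours] -/
theorem coordAvg_pathHolonomy [NeZero L] {s : Finset (Edge d L)} {F : GaugeConfig d L G → ℝ}
    (hF : IsGaugeInvariant F) {y : Site d L} {ℓ₁ ℓ₂ : Edge d L} (hne : ℓ₁ ≠ ℓ₂)
    (h₁ : ℓ₁.1.shift ℓ₁.2 = y) (h₁' : ℓ₁.1 ≠ y) (h₂ : ℓ₂.1 = y) (h₂' : ℓ₂.1.shift ℓ₂.2 ≠ y)
    (hstar : ∀ e : Edge d L, e.1 = y ∨ e.1.shift e.2 = y → e ≠ ℓ₁ → e ≠ ℓ₂ → e ∈ s)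
    (U : GaugeConfig d L G) (g : G) :
    coordAvg (haarProbability G) s F (update (update U ℓ₁ (U ℓ₁ * g⁻¹)) ℓ₂ (g * U ℓ₂)) =
      coordAvg (haarProbability G) s F U := by
  refine coordAvg_eq_of_gaugeRelated_off s hF (Pi.mulSingle y g) fun e he => ?_
  by_cases he₂ : e = ℓ₂
  · subst he₂
    rw [update_self, gaugeTransform_mulSingle_apply_of_fst_eq g U h₂ h₂']
  rw [update_of_ne he₂]
  by_cases he₁ : e = ℓ₁
  · subst he₁
    rw [update_self, gaugeTransform_mulSingle_apply_of_shift_eq g U h₁' h₁]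
  rw [update_of_ne he₁]
  have hni : ¬ (e.1 = y ∨ e.1.shift e.2 = y) := fun hi => he (hstar e hi he₁ he₂)
  exact (gaugeTransform_mulSingle_apply_of_not_incident y g U (fun h1 => hni (Or.inl h1))
    (fun h2 => hni (Or.inr h2))).symm

/-! ## §2 Burial: a link whose endpoint has all its other links integrated out drops out -/

/-- **Burial ⇒ independence.**  Let `F` be gauge invariant, `ℓ ∉ s` a link that is not a loop,
incident to the site `x`, and suppose every OTHER link incident to `x` lies in `s` (`ℓ` is BURIED by
`s` at `x`).  Then the partial Haar marginal `A_s F` does not depend on `U_ℓ`: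
`A_s F (U[ℓ ↦ h]) = A_s F (U)` for every `h : G`.  Proof: the rotation `g` at `x` with
`(U^{g at x})_ℓ = h` (`exists_gaugeTransform_mulSingle_apply_eq`) changes, besides `ℓ`, only links of
`s`, which `A_s` does not read (`coordAvg_congr_off`); and `A_s F` is gauge invariant
(`isGaugeInvariant_coordAvg`). [ours] -/
theorem coordAvg_update_of_buried [NeZero L] {s : Finset (Edge d L)} {F : GaugeConfig d L G → ℝ}
    (hF : IsGaugeInvariant F) {x : Site d L} {ℓ : Edge d L}
    (hinc : ℓ.1 = x ∨ ℓ.1.shift ℓ.2 = x) (hloop : ℓ.1 ≠ ℓ.1.shift ℓ.2)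
    (hstar : ∀ e : Edge d L, e.1 = x ∨ e.1.shift e.2 = x → e ≠ ℓ → e ∈ s)
    (U : GaugeConfig d L G) (h : G) :
    coordAvg (haarProbability G) s F (update U ℓ h) = coordAvg (haarProbability G) s F U := by
  obtain ⟨g, hg⟩ := exists_gaugeTransform_mulSingle_apply_eq U hinc hloop h
  -- `U[ℓ ↦ h]` and `U^{g at x}` agree off `s`
  refine coordAvg_eq_of_gaugeRelated_off s hF (Pi.mulSingle x g) fun e he => ?_
  by_cases heℓ : e = ℓ
  · subst heℓ
    rw [update_self, hg]
  · rw [update_of_ne heℓ]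
    have hni : ¬ (e.1 = x ∨ e.1.shift e.2 = x) := fun hi => he (hstar e hi heℓ)
    exact (gaugeTransform_mulSingle_apply_of_not_incident x g U (fun h1 => hni (Or.inl h1))
      (fun h2 => hni (Or.inr h2))).symm

/-- Burial, two-configuration form: if `U` and `U'` agree off `s` except possibly at the buried
link `ℓ`, their marginals agree. [ours] -/
theorem coordAvg_eq_of_buried [NeZero L] {s : Finset (Edge d L)} {F : GaugeConfig d L G → ℝ}
    (hF : IsGaugeInvariant F) {x : Site d L} {ℓ : Edge d L}
    (hinc : ℓ.1 = x ∨ ℓ.1.shift ℓ.2 = x) (hloop : ℓ.1 ≠ ℓ.1.shift ℓ.2)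
    (hstar : ∀ e : Edge d L, e.1 = x ∨ e.1.shift e.2 = x → e ≠ ℓ → e ∈ s)
    {U U' : GaugeConfig d L G} (hUU' : ∀ e, e ∉ s → e ≠ ℓ → U e = U' e) :
    coordAvg (haarProbability G) s F U = coordAvg (haarProbability G) s F U' := by
  rw [← coordAvg_update_of_buried hF hinc hloop hstar U (U' ℓ)]
  refine coordAvg_congr_off s F fun e he => ?_
  by_cases heℓ : e = ℓ
  · subst heℓ; rw [update_self]
  · rw [update_of_ne heℓ]; exact hUU' e he heℓ

/-- **Several buried links at once**: if every link of `R` is buried by `s` (each at some site),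
the marginal `A_s F` of a gauge-invariant `F` does not read the links of `R` either: configurations
agreeing off `s ∪ R` have the same marginal. [ours] -/
theorem coordAvg_eq_of_forall_buried [NeZero L] {s : Finset (Edge d L)} {F : GaugeConfig d L G → ℝ}
    (hF : IsGaugeInvariant F) (R : Finset (Edge d L))
    (hR : ∀ ℓ ∈ R, ℓ.1 ≠ ℓ.1.shift ℓ.2 ∧ ∃ x : Site d L, (ℓ.1 = x ∨ ℓ.1.shift ℓ.2 = x) ∧
      ∀ e : Edge d L, e.1 = x ∨ e.1.shift e.2 = x → e ≠ ℓ → e ∈ s) :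
    ∀ {U U' : GaugeConfig d L G}, (∀ e, e ∉ s → e ∉ R → U e = U' e) →
      coordAvg (haarProbability G) s F U = coordAvg (haarProbability G) s F U' := by
  classical
  induction R using Finset.induction_on with
  | empty =>
    intro U U' h
    exact coordAvg_congr_off s F fun e he => h e he (Finset.notMem_empty e)
  | @insert ℓ R hℓR ih =>
    intro U U' h
    obtain ⟨hloop, x, hinc, hstar⟩ := hR ℓ (Finset.mem_insert_self ℓ R)
    have hR' : ∀ ℓ' ∈ R, ℓ'.1 ≠ ℓ'.1.shift ℓ'.2 ∧ ∃ x : Site d L, (ℓ'.1 = x ∨ ℓ'.1.shift ℓ'.2 = x) ∧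
        ∀ e : Edge d L, e.1 = x ∨ e.1.shift e.2 = x → e ≠ ℓ' → e ∈ s :=
      fun ℓ' hℓ' => hR ℓ' (Finset.mem_insert_of_mem hℓ')
    -- move the `ℓ`-coordinate first (burial), then the `R`-coordinates (induction)
    calc coordAvg (haarProbability G) s F U
        = coordAvg (haarProbability G) s F (update U ℓ (U' ℓ)) :=
          (coordAvg_update_of_buried hF hinc hloop hstar U (U' ℓ)).symm
      _ = coordAvg (haarProbability G) s F U' := by
          refine ih hR' fun e he heR => ?_
          by_cases heℓ : e = ℓ
          · subst heℓ; rw [update_self]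
          · rw [update_of_ne heℓ]
            exact h e he (by simp [heℓ, heR])

/-! ## §3 The autoregressive reading (def-free) -/

/-- **The exact autoregressive conditional does not read a buried generated link.**  In an exact
autoregressive (triangular) sampler of a weight `F · ⊗Haar` in link variables, the conditional
density of the link `a` given the links generated so far integrates the not-yet-generated links
`s` (`a ∉ s`): it is `A_s F (U) / A_{insert a s} F (U)` as a function of `U_a` and of the generated
links.  If a generated link `ℓ` is buried by `s` at a site `x`, this conditional is the same at
`U` and at `U[ℓ ↦ h]` for every `h`: `ℓ` is not in the context of `a` (both marginals are blind to
`U_ℓ`; `insert a s` buries `ℓ` at `x` as well).  (In the intended reading `a ∉ s`, `a ≠ ℓ`, so `a`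
does not touch `x`; the identity needs none of this.) [ours] -/
theorem arConditional_update_of_buried [NeZero L] {s : Finset (Edge d L)}
    {F : GaugeConfig d L G → ℝ} (hF : IsGaugeInvariant F) {x : Site d L} {ℓ : Edge d L}
    (a : Edge d L) (hinc : ℓ.1 = x ∨ ℓ.1.shift ℓ.2 = x) (hloop : ℓ.1 ≠ ℓ.1.shift ℓ.2)
    (hstar : ∀ e : Edge d L, e.1 = x ∨ e.1.shift e.2 = x → e ≠ ℓ → e ∈ s)
    (U : GaugeConfig d L G) (h : G) :
    coordAvg (haarProbability G) s F (update U ℓ h) /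
        coordAvg (haarProbability G) (insert a s) F (update U ℓ h) =
      coordAvg (haarProbability G) s F U / coordAvg (haarProbability G) (insert a s) F U := by
  have hstar' : ∀ e : Edge d L, e.1 = x ∨ e.1.shift e.2 = x → e ≠ ℓ → e ∈ insert a s :=
    fun e he hne => Finset.mem_insert_of_mem (hstar e he hne)
  rw [coordAvg_update_of_buried hF hinc hloop hstar U h,
    coordAvg_update_of_buried hF hinc hloop hstar' U h]

/-- The same for the UN-NORMALISED pair: numerator and denominator are separately blind to the
buried link (useful when the denominator may vanish). [ours] -/
theorem arMarginals_update_of_buried [NeZero L] {s : Finset (Edge d L)}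
    {F : GaugeConfig d L G → ℝ} (hF : IsGaugeInvariant F) {x : Site d L} {ℓ : Edge d L}
    (a : Edge d L) (hinc : ℓ.1 = x ∨ ℓ.1.shift ℓ.2 = x) (hloop : ℓ.1 ≠ ℓ.1.shift ℓ.2)
    (hstar : ∀ e : Edge d L, e.1 = x ∨ e.1.shift e.2 = x → e ≠ ℓ → e ∈ s)
    (U : GaugeConfig d L G) (h : G) :
    coordAvg (haarProbability G) s F (update U ℓ h) = coordAvg (haarProbability G) s F U ∧
      coordAvg (haarProbability G) (insert a s) F (update U ℓ h) =
        coordAvg (haarProbability G) (insert a s) F U := by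
  have hstar' : ∀ e : Edge d L, e.1 = x ∨ e.1.shift e.2 = x → e ≠ ℓ → e ∈ insert a s :=
    fun e he hne => Finset.mem_insert_of_mem (hstar e he hne)
  exact ⟨coordAvg_update_of_buried hF hinc hloop hstar U h,
    coordAvg_update_of_buried hF hinc hloop hstar' U h⟩

/-! ## §4 (GEN-16) The autoregressive ratio: gauge invariant; gauge relations tested on covers -/

/-- **Every exact autoregressive conditional of a gauge theory is a gauge-invariant function of
(current link, generated links)**: the ratio `A_s F / A_{insert a s} F` takes the same value at `U^γ`
and at `U`, for every `γ` (numerator and denominator are gauge-invariant observables,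
`isGaugeInvariant_coordAvg`). [ours] -/
theorem arConditional_gaugeTransform [NeZero L] (s : Finset (Edge d L)) (a : Edge d L)
    {F : GaugeConfig d L G → ℝ} (hF : IsGaugeInvariant F) (γ : Site d L → G)
    (U : GaugeConfig d L G) :
    coordAvg (haarProbability G) s F (gaugeTransform γ U) /
        coordAvg (haarProbability G) (insert a s) F (gaugeTransform γ U) =
      coordAvg (haarProbability G) s F U / coordAvg (haarProbability G) (insert a s) F U := by
  rw [isGaugeInvariant_coordAvg s hF γ U, isGaugeInvariant_coordAvg (insert a s) hF γ U]

/-- The master identity with the gauge relation tested on a COVER of the retained set: if every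
link off `s` satisfies `R`, and `U'` agrees with `U^γ` on the links satisfying `R` (a cycle, a
forest, a list of links …), then `A_s F (U') = A_s F (U)`. [ours] -/
theorem coordAvg_eq_of_gaugeRelated_on_cover [NeZero L] (s : Finset (Edge d L))
    {F : GaugeConfig d L G → ℝ} (hF : IsGaugeInvariant F) {R : Edge d L → Prop}
    (hcover : ∀ e, e ∉ s → R e) (γ : Site d L → G) {U U' : GaugeConfig d L G}
    (h : ∀ e, R e → gaugeTransform γ U e = U' e) :
    coordAvg (haarProbability G) s F U' = coordAvg (haarProbability G) s F U :=
  coordAvg_eq_of_gaugeRelated_off s hF γ fun e he => (h e (hcover e he)).symm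

/-- **The autoregressive ratio under gauge relations on covers.**  If `U'` is gauge related to `U`
(by some `γ₁`) on a cover of the links off `s`, and (by some, possibly different, `γ₂`) on a cover
of the links off `insert a s`, then the exact conditional `A_s F / A_{insert a s} F` of the link `a`
takes the same value at `U'` and at `U`.  (The sequel instantiates the two covers with a cycle
through `a` plus forests, and with the path left when `a` is removed.) [ours] -/
theorem arConditional_eq_of_gaugeRelated_on_covers [NeZero L] (s : Finset (Edge d L))
    (a : Edge d L) {F : GaugeConfig d L G → ℝ} (hF : IsGaugeInvariant F)
    {R₁ R₂ : Edge d L → Prop} (hcover₁ : ∀ e, e ∉ s → R₁ e)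
    (hcover₂ : ∀ e, e ∉ insert a s → R₂ e) {U U' : GaugeConfig d L G}
    (h₁ : ∃ γ₁ : Site d L → G, ∀ e, R₁ e → gaugeTransform γ₁ U e = U' e)
    (h₂ : ∃ γ₂ : Site d L → G, ∀ e, R₂ e → gaugeTransform γ₂ U e = U' e) :
    coordAvg (haarProbability G) s F U' / coordAvg (haarProbability G) (insert a s) F U' =
      coordAvg (haarProbability G) s F U / coordAvg (haarProbability G) (insert a s) F U := by
  obtain ⟨γ₁, hγ₁⟩ := h₁
  obtain ⟨γ₂, hγ₂⟩ := h₂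
  rw [coordAvg_eq_of_gaugeRelated_on_cover s hF hcover₁ γ₁ hγ₁,
    coordAvg_eq_of_gaugeRelated_on_cover (insert a s) hF hcover₂ γ₂ hγ₂]

/-- **Several buried generated links drop out of the conditional at once**: if every link of `R`
is buried by `s`, the exact conditional `A_s F / A_{insert a s} F` takes the same value on any two
configurations agreeing off `s ∪ R` (each buried link is buried by `insert a s` as well). [ours] -/
theorem arConditional_eq_of_forall_buried [NeZero L] {s : Finset (Edge d L)} (a : Edge d L)
    {F : GaugeConfig d L G → ℝ} (hF : IsGaugeInvariant F) (R : Finset (Edge d L))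
    (hR : ∀ ℓ ∈ R, ℓ.1 ≠ ℓ.1.shift ℓ.2 ∧ ∃ x : Site d L, (ℓ.1 = x ∨ ℓ.1.shift ℓ.2 = x) ∧
      ∀ e : Edge d L, e.1 = x ∨ e.1.shift e.2 = x → e ≠ ℓ → e ∈ s)
    {U U' : GaugeConfig d L G} (hUU' : ∀ e, e ∉ s → e ∉ R → U e = U' e) :
    coordAvg (haarProbability G) s F U / coordAvg (haarProbability G) (insert a s) F U =
      coordAvg (haarProbability G) s F U' / coordAvg (haarProbability G) (insert a s) F U' := by
  have hR' : ∀ ℓ ∈ R, ℓ.1 ≠ ℓ.1.shift ℓ.2 ∧ ∃ x : Site d L, (ℓ.1 = x ∨ ℓ.1.shift ℓ.2 = x) ∧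
      ∀ e : Edge d L, e.1 = x ∨ e.1.shift e.2 = x → e ≠ ℓ → e ∈ insert a s := by
    intro ℓ hℓ
    obtain ⟨hloop, x, hinc, hstar⟩ := hR ℓ hℓ
    exact ⟨hloop, x, hinc, fun e he hne => Finset.mem_insert_of_mem (hstar e he hne)⟩
  rw [coordAvg_eq_of_forall_buried hF R hR hUU',
    coordAvg_eq_of_forall_buried hF R hR' fun e he heR =>
      hUU' e (fun hes => he (Finset.mem_insert_of_mem hes)) heR]

end Marginal

end Summit.Ventures.LatticeQCDFlow.Theory2.Autoregressive

end
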